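import Mathlib
import HarnessLib
import Summits.HubbardSuperconductivity.HubbardSuperconductivity.Theorems.KLProgrammeKLRegimeTwoVolumeLipDoubledTruncIdentity
import Summits.HubbardSuperconductivity.HubbardSuperconductivity.Theorems.KLProgrammeKLRegimeTwoVolumeLipDoubledBlockStepDeepGeneric
import Summits.HubbardSuperconductivity.HubbardSuperconductivity.Theorems.KLProgrammeKLRegimeTwoVolumeLipDoubledSourceTransferGeneric
import Summits.HubbardSuperconductivity.HubbardSuperconductivity.Theorems.KLProgrammeKLRegimeTwoVolumeLipBornDiffStepRate
import Summits.HubbardSuperconductivity.HubbardSuperconductivity.Theorems.KLProgrammeKLRegimeTwoVolumeLipDiffSups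
import Summits.HubbardSuperconductivity.HubbardSuperconductivity.Theorems.KLProgrammeKLRegimeTwoVolumeLipBornDiffHstepRate

/-!
# Route `KLProgramme` — crux K3 ENGINE (stmt-HubbardSuperconductivity-20437), stub (e) proof-input «(e)-D-ROWS», keying (A′), REKEY-D file D4T + D5T-a:
# THE (Db)⁺ ROW OF THE SOURCE-TRUNCATED DOUBLED (plain-track) TWO-VOLUME LIPSCHITZ TOWER at a deep pin of either copy (free profile, free rate), its KIT FORM and UNITS FORM
# (seat hubbard-kl-k3c4-p1 g28; truncated twin of ✓ D4 `…TwoVolumeLipDoubledBornDiffStepRate.klLipBornDiffD_pinned_le_step_of_profile_rate`; `--supports` 23356)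

* **`klLipBornDiffDT_pinned_le_step_of_profile_rate`** — DT1 `sum_pinned_norm_kernel_klLipBornDiffDT_le_of_parts` with the LIP part from ✓ D2′ `lipBlockStepD_deep_rate_le_of`
  (`V = klGlueD (klLipInputDT L)`, `D = klLipInputDiffDT`; transfer rows from E1's `klScaleWt`-weighted rows via ✓ `one_add_mul_tnorm_le_klScaleWt_pair` / ✓ `transfer_col_le/rowF_le/tauF_le`;
  plain-pin partner fact discharged) and the SRC part from ✓ D3b′ `lipSourceTransferD_le_of_wtRows_of` (`I = klLipInputDT L`).  Same displayed right-hand side as D4; the profiles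
  `NV, ND, E, N, N_far, Es, NDs` now read the TRUNCATED objects (one profile per degree, all `s < 3` plain legs together);
* `klLipBornDiffDT_pinned_le_kit_rate` — the same in kit form (the door's smallness replaced by the kit's guards, `E ≥ klLipInputDiffSupDT … (2m′) R`; ✓ `lipDoor_le_kit`);
* `klLipBornDiffDT_pinned_le_kit_units_rate` — the same in any units `(u, K_c)` (✓ `lipKit_abs_eq_units`) — truncated-doubled twins of ✓ `klLipBornDiff_pinned_le_kit(_units)_rate`.

Composition of landed theorems; every block constant / profile / row is a hypothesis; nothing asserts the (D) rows, (e), VL, K3 or superconductivity.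
References: BGM 2006 §2.8 (2.76)–(2.90), §2.9 (4.3)–(4.6), §3 (3.2)–(3.8) [cite: BenfattoGiulianiMastropietro2006]; Salmhofer 1998 §4.1.
-/

noncomputable section

namespace Summit.HubbardSuperconductivity.HubbardSuperconductivity.Theorems.TwoVolumeLip

set_option linter.dupNamespace false -- summit = problem name (single-conjunct summit), D-0017

open Finset Literature.MathematicalPhysics.QuantumLattice GrassmannAlgebra Literature.Probability.LatticeModels
  Literature.Probability.LatticeModels.BattleFederbush
open Literature.MathematicalPhysics.QuantumLattice.FermiRG
open Summit.HubbardSuperconductivity.HubbardSuperconductivity.Theorems.KLRegimeSplit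
open Summit.HubbardSuperconductivity.HubbardSuperconductivity.Theorems.KLProgrammeLegKernels
open Summit.HubbardSuperconductivity.HubbardSuperconductivity.Theorems.DispersionFlow
open Summit.HubbardSuperconductivity.HubbardSuperconductivity.Theorems.EngineV8
open Summit.HubbardSuperconductivity.HubbardSuperconductivity.Theorems.TwoVolumeSource
open Summit.HubbardSuperconductivity.HubbardSuperconductivity.Theorems.TwoVolumeDefect

/-! ## D4T THE (Db)⁺ ROW OF THE TRUNCATED TOWER at a deep pin of either copy (free profile, free rate) -/

section RowDbDT

variable {L b M : ℕ} [NeZero L] [NeZero (b * L)] [NeZero M]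

set_option maxHeartbeats 400000 in -- two large door applications in one declaration
/-- **THE (Db)⁺ ROW OF THE SOURCE-TRUNCATED doubled (plain-track) two-volume Lipschitz tower at a deep pin of EITHER copy, free deep-pin profile `E`, free weight rate `j_w`** — ✓ D4 `klLipBornDiffD_pinned_le_step_of_profile_rate` for the truncated objects of `…TwoVolumeLipDoubledTruncDefs` (DT1 `sum_pinned_norm_kernel_klLipBornDiffDT_le_of_parts` with the LIP part from ✓ D2′ `lipBlockStepD_deep_rate_le_of` at `V = klGlueD (klLipInputDT L)`, `D = klLipInputDiffDT` and the SRC part from ✓ D3b′ `lipSourceTransferD_le_of_wtRows_of` at `I = klLipInputDT L`); the doubled twin of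
✓ `klLipBornDiff_pinned_le_step_of_profile_rate`: D4a `sum_pinned_norm_kernel_klLipBornDiffD_le_of_parts` with the LIP part from ✓ D2 `lipBlockStepD_deep_rate_le` and the SRC part from
✓ D3b `lipSourceTransferD_le_of_wtRows`.  Data: the SECTOR covariance data (`κ`, weighted rows `α` of the fine block covariance) and transfer data (E1's `klScaleWt`-weighted rows
`cW ≥ 1` of `klLipTransfer (bL)`), the doubled weighted profiles `NV` (glued coarse doubled input), `ND` (doubled input difference), a free deep-pin majorant `E` of the doubled
input difference, the coarse doubled born profiles `N, N_far`, the doubled source-defect profiles `Es, NDs`; output pin `w″` with `w″.1 ∈ klDeepPins L (D₀ + r)`. -/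
theorem klLipBornDiffDT_pinned_le_step_of_profile_rate {β : ℝ} (hβ : 0 < β) (U μ : ℝ) (K : TrigPolyC4v) {d k jw : ℕ} (hdk : 1 ≤ d * k)
    (hZf : hubbardEffPartitionFnCT (b * L) M β U μ 0 K (klScale klE0 (d * k)) ≠ 0)
    (hZc : hubbardEffPartitionFnCT L M β U μ 0 K (klScale klE0 (d * k)) ≠ 0)
    {κ : ℝ} (hκ : 0 < κ) (hGB : IsGramBoundedR ((sectorSubMatrix (b * L) M β (bgmFatMultiplier (b * L) M klE0 β (nambuXiCT (b * L) μ K) (d * k - 1))).transpose * hubbardCovSliceCT (b * L) M β μ 0 K (klScale klE0 (d * (k + 1))) (klScale klE0 (d * k)) * sectorSubMatrix (b * L) M β (bgmFatMultiplier (b * L) M klE0 β (nambuXiCT (b * L) μ K) (d * k - 1))) κ)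
    (NV ND : ℕ → ℝ) (hNV0 : ∀ m', 0 ≤ NV m') (hND0 : ∀ m', 0 ≤ ND m')
    (hNV : ∀ m' (j : Fin (2 * m')) (x : SrcLabel (b * L) M (d * k - 1)), ∑ Y ∈ univ.filter (fun Y : Fin (2 * m') → SrcLabel (b * L) M (d * k - 1) => Y j = x),
      ‖kernel ℂ (klGlueD L b M (d * k - 1) (klLipInputDT L M β U μ K d k)) (2 * m') Y‖ * klGluedWt L b M β jw (sectorCount (d * k - 1)) ((univ.image Y).image Prod.fst) ≤ NV m')
    (hND : ∀ m' (j : Fin (2 * m')) (x : SrcLabel (b * L) M (d * k - 1)), ∑ Y ∈ univ.filter (fun Y : Fin (2 * m') → SrcLabel (b * L) M (d * k - 1) => Y j = x),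
      ‖kernel ℂ (klLipInputDiffDT L b M β U μ K d k) (2 * m') Y‖ * klGluedWt L b M β jw (sectorCount (d * k - 1)) ((univ.image Y).image Prod.fst) ≤ ND m')
    (R R' : ℕ) (E : ℕ → ℝ) (hE0 : ∀ m', 0 ≤ E m')
    (hE : ∀ m' (j : Fin (2 * m')) (x : SrcLabel (b * L) M (d * k - 1)), x ∈ klDeepPinsD (V := b * L) (M := M) (n := d * k - 1) L R →
      ∑ Y ∈ univ.filter (fun Y : Fin (2 * m') → SrcLabel (b * L) M (d * k - 1) => Y j = x), ‖kernel ℂ (klLipInputDiffDT L b M β U μ K d k) (2 * m') Y‖ ≤ E m')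
    {α : ℝ} (hα : 0 < α)
    (hrow : ∀ X, ∑ Y, ‖((sectorSubMatrix (b * L) M β (bgmFatMultiplier (b * L) M klE0 β (nambuXiCT (b * L) μ K) (d * k - 1))).transpose * hubbardCovSliceCT (b * L) M β μ 0 K (klScale klE0 (d * (k + 1))) (klScale klE0 (d * k)) * sectorSubMatrix (b * L) M β (bgmFatMultiplier (b * L) M klE0 β (nambuXiCT (b * L) μ K) (d * k - 1))) X Y‖ * klGluedWt L b M β jw (sectorCount (d * k - 1)) {X, Y} ≤ α)
    (hcol : ∀ Y, ∑ X, ‖((sectorSubMatrix (b * L) M β (bgmFatMultiplier (b * L) M klE0 β (nambuXiCT (b * L) μ K) (d * k - 1))).transpose * hubbardCovSliceCT (b * L) M β μ 0 K (klScale klE0 (d * (k + 1))) (klScale klE0 (d * k)) * sectorSubMatrix (b * L) M β (bgmFatMultiplier (b * L) M klE0 β (nambuXiCT (b * L) μ K) (d * k - 1))) X Y‖ * klGluedWt L b M β jw (sectorCount (d * k - 1)) {X, Y} ≤ α)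
    {ρ : ℝ} (hρ : 0 < ρ)
    (hθ₁ : Real.exp 1 * α * normV (SrcLabel (b * L) M (d * k - 1)) κ ρ (fun m' => NV m' + ND m' + E m') / κ ^ 2 < 1)
    (hθ₂ : Real.exp 1 * α * normV (SrcLabel (b * L) M (d * k - 1)) κ ρ (fun m' => NV m' + ND m') / κ ^ 2 < 1)
    {N₀ : ℕ} (hN₀ : 2 ≤ N₀)
    {Λ : ℝ} (hΛ0 : 0 < Λ) (hΛle : Λ ≤ 1 + klScale klE0 jw * ((R' : ℝ) + 1))
    (jr : ℕ) {ΛT cW : ℝ} (hΛT : 0 ≤ ΛT) (hΛr : ΛT ≤ klScale klE0 jr) (hcW1 : 1 ≤ cW)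
    (hrowT : ∀ x, ∑ y', ‖klLipTransfer (b * L) M β μ K d k x y'‖ *
      klScaleWt (b * L) M β jr {latticeLegPos (2 * (2 * M)) x, latticeLegPos (2 * (2 * M)) y'} ≤ cW)
    (hcolT : ∀ y', ∑ x, ‖klLipTransfer (b * L) M β μ K d k x y'‖ *
      klScaleWt (b * L) M β jr {latticeLegPos (2 * (2 * M)) x, latticeLegPos (2 * (2 * M)) y'} ≤ cW)
    (D₀ r : ℕ) (hD₀ : 2 * r ≤ D₀) (hRR' : R + R' ≤ D₀)
    {n q : ℕ} (hq : 2 * q = n + 1)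
    {N Nfar Es NDs : ℝ} (hN0 : 0 ≤ N) (hNfar0 : 0 ≤ Nfar) (hEs0 : 0 ≤ Es) (hNDs0 : 0 ≤ NDs)
    (hN : ∀ (p : Fin (n + 1)) y, ∑ Y ∈ univ.filter (fun Y : Fin (n + 1) → SrcLabel L M (d * k - 1) => Y p = y),
      ‖kernel ℂ (effAction ℂ (klLipCovD L M β μ K d k) (klLipInputDT L M β U μ K d k) - klLipInputDT L M β U μ K d k) (n + 1) Y‖ ≤ N)
    (hNfar : ∀ (p : Fin (n + 1)) y (i : Fin (n + 1)),
      ∑ Y ∈ univ.filter (fun Y : Fin (n + 1) → SrcLabel L M (d * k - 1) => Y p = y ∧ r < Torus.tnorm ((Y p).1.1.2 - (Y i).1.1.2)),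
        ‖kernel ℂ (effAction ℂ (klLipCovD L M β μ K d k) (klLipInputDT L M β U μ K d k) - klLipInputDT L M β U μ K d k) (n + 1) Y‖ ≤ Nfar)
    (hEs : ∀ (p : Fin (n + 1)) (y' : SrcLabel (b * L) M (d * k - 1)), y' ∈ klDeepPinsD (V := b * L) (M := M) (n := d * k - 1) L D₀ →
      ∑ Y' ∈ univ.filter (fun Y' : Fin (n + 1) → SrcLabel (b * L) M (d * k - 1) => Y' p = y'),
        ‖kernel ℂ ((effAction ℂ (klLipCovD (b * L) M β μ K d k) (klGlueD L b M (d * k - 1) (klLipInputDT L M β U μ K d k)) -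
              klGlueD L b M (d * k - 1) (klLipInputDT L M β U μ K d k)) -
            klGlueD L b M (d * k - 1)
              (effAction ℂ (klLipCovD L M β μ K d k) (klLipInputDT L M β U μ K d k) - klLipInputDT L M β U μ K d k)) (n + 1) Y'‖ ≤ Es)
    (hNDs : ∀ (p : Fin (n + 1)) (y' : SrcLabel (b * L) M (d * k - 1)),
      ∑ Y' ∈ univ.filter (fun Y' : Fin (n + 1) → SrcLabel (b * L) M (d * k - 1) => Y' p = y'),
        ‖kernel ℂ ((effAction ℂ (klLipCovD (b * L) M β μ K d k) (klGlueD L b M (d * k - 1) (klLipInputDT L M β U μ K d k)) -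
              klGlueD L b M (d * k - 1) (klLipInputDT L M β U μ K d k)) -
            klGlueD L b M (d * k - 1)
              (effAction ℂ (klLipCovD L M β μ K d k) (klLipInputDT L M β U μ K d k) - klLipInputDT L M β U μ K d k)) (n + 1) Y'‖ ≤ NDs)
    (p : Fin (n + 1)) (w'' : SrcLabel (b * L) M (d * k)) (hw'' : w''.1 ∈ klDeepPins L (D₀ + r)) :
    ∑ X'' ∈ univ.filter (fun X'' : Fin (n + 1) → SrcLabel (b * L) M (d * k) => X'' p = w''),
        ‖kernel ℂ (klLipBornDiffDT L b M β U μ K d k) (n + 1) X''‖ ≤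
      cW ^ (2 * q - 1) * (cW *
        ((∑ m' ∈ range (Fintype.card (SrcLabel (b * L) M (d * k - 1)) / 2 + 1), if q < m' then ((2 * m').choose (2 * q) : ℝ) * κ ^ (2 * m' - 2 * q) * E m' else 0) +
          Λ⁻¹ * ∑ m' ∈ range (Fintype.card (SrcLabel (b * L) M (d * k - 1)) / 2 + 1),
            if q < m' then ((2 * m').choose (2 * q) : ℝ) * κ ^ (2 * m' - 2 * q) * ND m' else 0) +
        cW / (1 + ΛT * ((r : ℝ) + 1)) * ∑ m' ∈ range (Fintype.card (SrcLabel (b * L) M (d * k - 1)) / 2 + 1), if q < m' then ((2 * m').choose (2 * q) : ℝ) * κ ^ (2 * m' - 2 * q) * ND m' else 0) +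
      cW ^ (2 * q - 1) * (cW *
        ((∑ n' ∈ Ico 2 N₀, (ρ⁻¹ ^ (2 * q) * κ⁻¹ ^ (2 * (n' - 1)) * (α ^ (n' - 1) * Real.exp n')) *
            ∑ δ ∈ (Fintype.piFinset fun _ : Fin n' => range (Fintype.card (SrcLabel (b * L) M (d * k - 1)) / 2 + 1)) with 2 * q + 2 * (n' - 1) ≤ ∑ a, 2 * δ a,
              ∑ a, (Real.exp 2 * (κ + ρ)) ^ (2 * δ a) * E (δ a) *
                ∏ b' ∈ univ.erase a, (Real.exp 2 * (κ + ρ)) ^ (2 * δ b') * (NV (δ b') + ND (δ b') + E (δ b')) +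
          2 * (ρ⁻¹ ^ (2 * q) * (Real.exp 1 * normV (SrcLabel (b * L) M (d * k - 1)) κ ρ (fun m' => NV m' + ND m' + E m')) *
            (Real.exp 1 * α * normV (SrcLabel (b * L) M (d * k - 1)) κ ρ (fun m' => NV m' + ND m' + E m') / κ ^ 2) ^ (N₀ - 1) /
              (1 - Real.exp 1 * α * normV (SrcLabel (b * L) M (d * k - 1)) κ ρ (fun m' => NV m' + ND m' + E m') / κ ^ 2))) +
        Λ⁻¹ * (∑ n' ∈ Ico 2 N₀, (ρ⁻¹ ^ (2 * q) * κ⁻¹ ^ (2 * (n' - 1)) * (α ^ (n' - 1) * Real.exp n')) *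
            ∑ δ ∈ (Fintype.piFinset fun _ : Fin n' => range (Fintype.card (SrcLabel (b * L) M (d * k - 1)) / 2 + 1)) with 2 * q + 2 * (n' - 1) ≤ ∑ a, 2 * δ a,
              ∑ a, (Real.exp 2 * (κ + ρ)) ^ (2 * δ a) * ND (δ a) *
                ∏ b' ∈ univ.erase a, (Real.exp 2 * (κ + ρ)) ^ (2 * δ b') * (NV (δ b') + ND (δ b')) +
          Λ * (2 * (ρ⁻¹ ^ (2 * q) * (Real.exp 1 * normV (SrcLabel (b * L) M (d * k - 1)) κ ρ (fun m' => NV m' + ND m')) *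
            (Real.exp 1 * α * normV (SrcLabel (b * L) M (d * k - 1)) κ ρ (fun m' => NV m' + ND m') / κ ^ 2) ^ (N₀ - 1) /
              (1 - Real.exp 1 * α * normV (SrcLabel (b * L) M (d * k - 1)) κ ρ (fun m' => NV m' + ND m') / κ ^ 2))))) +
        cW / (1 + ΛT * ((r : ℝ) + 1)) * (∑ n' ∈ Ico 2 N₀, (ρ⁻¹ ^ (2 * q) * κ⁻¹ ^ (2 * (n' - 1)) * (α ^ (n' - 1) * Real.exp n')) *
            ∑ δ ∈ (Fintype.piFinset fun _ : Fin n' => range (Fintype.card (SrcLabel (b * L) M (d * k - 1)) / 2 + 1)) with 2 * q + 2 * (n' - 1) ≤ ∑ a, 2 * δ a,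
              ∑ a, (Real.exp 2 * (κ + ρ)) ^ (2 * δ a) * ND (δ a) *
                ∏ b' ∈ univ.erase a, (Real.exp 2 * (κ + ρ)) ^ (2 * δ b') * (NV (δ b') + ND (δ b')) +
          2 * (ρ⁻¹ ^ (2 * q) * (Real.exp 1 * normV (SrcLabel (b * L) M (d * k - 1)) κ ρ (fun m' => NV m' + ND m')) *
            (Real.exp 1 * α * normV (SrcLabel (b * L) M (d * k - 1)) κ ρ (fun m' => NV m' + ND m') / κ ^ 2) ^ (N₀ - 1) /
              (1 - Real.exp 1 * α * normV (SrcLabel (b * L) M (d * k - 1)) κ ρ (fun m' => NV m' + ND m') / κ ^ 2)))) +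
      (cW ^ n * (cW * Es + cW / (1 + ΛT * ((r : ℝ) + 1)) * NDs) +
        (2 * cW ^ n * (cW / (1 + ΛT * ((r : ℝ) + 1))) * N + n * cW ^ n * (5 * (cW / (1 + ΛT * ((r : ℝ) + 1))) * N + 2 * cW * Nfar))) := by
  have hwd : ∀ j, D₀ + r ≤ (w''.1.1.2 j).val % L ∧ (w''.1.1.2 j).val % L + (D₀ + r) < L := mem_klDeepPins.1 hw''
  have hcW : 0 ≤ cW := le_trans zero_le_one hcW1
  have hrowT' : ∀ x : SpaceTimeIdx (b * L) M × SectorLeg (sectorCount (d * k)),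
      ∑ y', ‖klLipTransfer (b * L) M β μ K d k x y'‖ * (1 + ΛT * (Torus.tnorm (x.1.2 - y'.1.2) : ℝ)) ≤ cW := fun x => by
    refine (sum_le_sum fun y' _ => ?_).trans (hrowT x)
    exact mul_le_mul_of_nonneg_left
      (one_add_mul_tnorm_le_klScaleWt_pair hβ.le hΛr ((x.1, y'.2) : SpaceTimeIdx (b * L) M × SectorLeg (sectorCount (d * k - 1))) y') (norm_nonneg _)
  have hcolT' : ∀ y' : SpaceTimeIdx (b * L) M × SectorLeg (sectorCount (d * k - 1)),
      ∑ x, ‖klLipTransfer (b * L) M β μ K d k x y'‖ * (1 + ΛT * (Torus.tnorm (x.1.2 - y'.1.2) : ℝ)) ≤ cW := fun y' => by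
    refine (sum_le_sum fun x _ => ?_).trans (hcolT y')
    exact mul_le_mul_of_nonneg_left
      (one_add_mul_tnorm_le_klScaleWt_pair hβ.le hΛr ((x.1, y'.2) : SpaceTimeIdx (b * L) M × SectorLeg (sectorCount (d * k - 1))) y') (norm_nonneg _)
  -- parity and constant parts of the truncated inputs
  have hIc : klTowerInput L M β U μ K d k ∈ evenOdd ℂ 0 :=
    Summit.HubbardSuperconductivity.HubbardSuperconductivity.Theorems.KLRegimeWick.klEffectiveAction_mem_evenOdd_zero β U μ K klE0 (d * k)
  have hIf : klTowerInput (b * L) M β U μ K d k ∈ evenOdd ℂ 0 :=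
    Summit.HubbardSuperconductivity.HubbardSuperconductivity.Theorems.KLRegimeWick.klEffectiveAction_mem_evenOdd_zero β U μ K klE0 (d * k)
  have hIc0 : constPart ℂ (klTowerInput L M β U μ K d k) = 0 := constPart_klEffectiveAction_eq_zero β U μ K klE0 (d * k) hZc
  have hIf0 : constPart ℂ (klTowerInput (b * L) M β U μ K d k) = 0 := constPart_klEffectiveAction_eq_zero β U μ K klE0 (d * k) hZf
  have hVe : klGlueD L b M (d * k - 1) (klLipInputDT L M β U μ K d k) ∈ evenOdd ℂ 0 := klGlueD_mem_evenOdd_zero (klLipInputDT_mem_evenOdd_zero hIc)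
  have hV0 : constPart ℂ (klGlueD L b M (d * k - 1) (klLipInputDT L M β U μ K d k)) = 0 := constPart_klGlueD (constPart_klLipInputDT hIc0)
  have hDe : klLipInputDiffDT L b M β U μ K d k ∈ evenOdd ℂ 0 := klLipInputDiffDT_mem_evenOdd_zero hIf hIc
  have hD0 : constPart ℂ (klLipInputDiffDT L b M β U μ K d k) = 0 := constPart_klLipInputDiffDT hIf0 hIc0
  refine sum_pinned_norm_kernel_klLipBornDiffDT_le_of_parts hβ.ne' U μ K hdk hZf hZc p w'' ?_ ?_
  · -- LIP: the doubled deep block-step door (D2) with the free profile `E`, near pins `tnorm ≤ r`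
    have hcolH := transfer_col_le (fun x : SpaceTimeIdx (b * L) M × SectorLeg (sectorCount (d * k)) => x.1.2)
      (fun y' : SpaceTimeIdx (b * L) M × SectorLeg (sectorCount (d * k - 1)) => y'.1.2) (klLipTransfer (b * L) M β μ K d k) hΛT hcolT'
    have hrowH := transfer_rowF_le (fun x : SpaceTimeIdx (b * L) M × SectorLeg (sectorCount (d * k)) => x.1.2)
      (fun y' : SpaceTimeIdx (b * L) M × SectorLeg (sectorCount (d * k - 1)) => y'.1.2) (klLipTransfer (b * L) M β μ K d k) hΛT hrowT' r w''.1
    have hτH := transfer_tauF_le (fun x : SpaceTimeIdx (b * L) M × SectorLeg (sectorCount (d * k)) => x.1.2)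
      (fun y' : SpaceTimeIdx (b * L) M × SectorLeg (sectorCount (d * k - 1)) => y'.1.2) (klLipTransfer (b * L) M β μ K d k) hΛT hrowT' hcW (le_refl r) w''.1
    have hW : w''.2 = 1 → ∀ y, klPlainShift (b * L) M (sectorCount (d * k)) (sectorCount (d * k - 1)) w''.1 y ≠ 0 →
        Torus.tnorm (w''.1.1.2 - y.1.2) ≤ r := by
      intro _ y hne
      rw [klPlainShift_ne_zero_site hne, sub_self]
      have h0 : Torus.tnorm (0 : TorusSite 2 (b * L)) = 0 := by
        have h : Torus.tnorm (0 : TorusSite 2 (b * L)) ≤ Site.supNorm (0 : Site 2) := by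
          have h1 := Torus.tnorm_proj_le (L := b * L) (0 : Site 2)
          have h00 : Torus.proj (b * L) (0 : Site 2) = 0 := by funext i; simp [Torus.proj_apply]
          rwa [h00] at h1
        have h2 : Site.supNorm (0 : Site 2) = 0 := Nat.le_zero.1 (Site.supNorm_le_iff.2 fun i => by simp)
        exact Nat.le_zero.1 (h2 ▸ h)
      rw [h0]; exact Nat.zero_le _
    refine le_of_eq_of_le (sum_pinned_norm_kernel_congr_deg _ hq p w'').symm ?_
    exact lipBlockStepD_deep_rate_le_of hβ μ K _ _ hVe hV0 hDe hD0 hκ hGB NV ND E hNV0 hND0 hE0 hNV hND R R' hE hα hrow hcol hρ hθ₁ hθ₂ hN₀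
      (fun y' => Torus.tnorm (w''.1.1.2 - y'.1.2) ≤ r) (fun y' hy' => klDeepPins_mono hRR' (mem_klDeepPins_of_tnorm_le hwd hy')) hcW1
      (div_nonneg hcW (by positivity)) hcolH w'' hrowH hτH hW hΛ0 hΛle (Fin.cast hq.symm p)
  · -- SRC: the doubled transfer door (D3b), rows discharged; `Es` read at the `D₀`-deep near pins
    exact lipSourceTransferD_le_of_wtRows_of hβ μ K (klLipInputDT L M β U μ K d k) hΛT hcW1 hrowT' hcolT' p w'' D₀ r hD₀ hwd hN0 hNfar0 hEs0 hNDs0 (hN p) (hNfar p)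
      (fun y' hy' => hEs p y' (mem_klDeepPinsD.2 (mem_klDeepPins_of_tnorm_le hwd hy'))) (hNDs p)

end RowDbDT

/-! ## D5T-a THE (Db)⁺ ROW IN KIT FORM AND IN DIMENSIONLESS UNITS (pin level) -/

section KitDT

open Literature.Probability.LatticeModels.BattleFederbush

variable {L b M : ℕ} [NeZero L] [NeZero (b * L)] [NeZero M]

set_option maxHeartbeats 400000 in -- the (Db) row and the dictionary in one declaration
/-- **The truncated doubled (Db)⁺ row in kit form (pin level)** — truncated-doubled twin of ✓ `klLipBornDiff_pinned_le_kit_rate`.  Hypotheses of `klLipBornDiffDT_pinned_le_step_of_profile_rate` with the door's smallness replaced by the kit's guards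
`hg₁`, `hg₂` (degree bound `D ≥ |Γ_k|/2`), `1 ≤ Λ ≤ 1 + Λ_{dk−1}(R′+1)`, and degree-`0` sizes `NV 0 = ND 0 = E 0 = 0`; conclusion = kit image of LIP + SRC. -/
theorem klLipBornDiffDT_pinned_le_kit_rate {β : ℝ} (hβ : 0 < β) (U μ : ℝ) (K : TrigPolyC4v) {d k jw : ℕ} (hdk : 1 ≤ d * k)
    (hZf : hubbardEffPartitionFnCT (b * L) M β U μ 0 K (klScale klE0 (d * k)) ≠ 0)
    (hZc : hubbardEffPartitionFnCT L M β U μ 0 K (klScale klE0 (d * k)) ≠ 0)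
    {κ : ℝ} (hκ : 0 < κ) (hGB : IsGramBoundedR ((sectorSubMatrix (b * L) M β (bgmFatMultiplier (b * L) M klE0 β (nambuXiCT (b * L) μ K) (d * k - 1))).transpose * hubbardCovSliceCT (b * L) M β μ 0 K (klScale klE0 (d * (k + 1))) (klScale klE0 (d * k)) * sectorSubMatrix (b * L) M β (bgmFatMultiplier (b * L) M klE0 β (nambuXiCT (b * L) μ K) (d * k - 1))) κ)
    (NV ND : ℕ → ℝ) (hNV0 : ∀ m', 0 ≤ NV m') (hND0 : ∀ m', 0 ≤ ND m')
    (hNV : ∀ m' (j : Fin (2 * m')) (x : (SrcLabel (b * L) M (d * k - 1))), ∑ Y ∈ univ.filter (fun Y : Fin (2 * m') → (SrcLabel (b * L) M (d * k - 1)) => Y j = x),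
      ‖kernel ℂ (klGlueD L b M (d * k - 1) (klLipInputDT L M β U μ K d k)) (2 * m') Y‖ * klGluedWt L b M β jw (sectorCount (d * k - 1)) ((univ.image Y).image Prod.fst) ≤ NV m')
    (hND : ∀ m' (j : Fin (2 * m')) (x : (SrcLabel (b * L) M (d * k - 1))), ∑ Y ∈ univ.filter (fun Y : Fin (2 * m') → (SrcLabel (b * L) M (d * k - 1)) => Y j = x),
      ‖kernel ℂ (klLipInputDiffDT L b M β U μ K d k) (2 * m') Y‖ * klGluedWt L b M β jw (sectorCount (d * k - 1)) ((univ.image Y).image Prod.fst) ≤ ND m')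
    (R R' : ℕ) (E : ℕ → ℝ) (hE0 : ∀ m', 0 ≤ E m') (hE : ∀ m', klLipInputDiffSupDT L b M β U μ K d k (2 * m') R ≤ E m')
    (hNV00 : NV 0 = 0) (hND00 : ND 0 = 0) (hE00 : E 0 = 0)
    {α : ℝ} (hα : 0 < α)
    (hrow : ∀ X, ∑ Y, ‖((sectorSubMatrix (b * L) M β (bgmFatMultiplier (b * L) M klE0 β (nambuXiCT (b * L) μ K) (d * k - 1))).transpose * hubbardCovSliceCT (b * L) M β μ 0 K (klScale klE0 (d * (k + 1))) (klScale klE0 (d * k)) * sectorSubMatrix (b * L) M β (bgmFatMultiplier (b * L) M klE0 β (nambuXiCT (b * L) μ K) (d * k - 1))) X Y‖ * klGluedWt L b M β jw (sectorCount (d * k - 1)) {X, Y} ≤ α)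
    (hcol : ∀ Y, ∑ X, ‖((sectorSubMatrix (b * L) M β (bgmFatMultiplier (b * L) M klE0 β (nambuXiCT (b * L) μ K) (d * k - 1))).transpose * hubbardCovSliceCT (b * L) M β μ 0 K (klScale klE0 (d * (k + 1))) (klScale klE0 (d * k)) * sectorSubMatrix (b * L) M β (bgmFatMultiplier (b * L) M klE0 β (nambuXiCT (b * L) μ K) (d * k - 1))) X Y‖ * klGluedWt L b M β jw (sectorCount (d * k - 1)) {X, Y} ≤ α)
    {ρ : ℝ} (hρ : 0 < ρ)
    {D : ℕ} (hD : Fintype.card (SrcLabel (b * L) M (d * k - 1)) / 2 ≤ D)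
    (hg₁ : Real.exp 1 * α / κ ^ 2 * towerV D ((Real.exp 2 * (κ + ρ)) ^ 2) (fun m' => NV m' + ND m' + E m') < 1)
    (hg₂ : Real.exp 1 * α / κ ^ 2 * towerV D ((Real.exp 2 * (κ + ρ)) ^ 2) (fun m' => NV m' + ND m') < 1)
    {N₀ : ℕ} (hN₀ : 2 ≤ N₀)
    {Λ : ℝ} (hΛ1 : 1 ≤ Λ) (hΛle : Λ ≤ 1 + klScale klE0 jw * ((R' : ℝ) + 1))
    (jr : ℕ) {ΛT cW : ℝ} (hΛT : 0 ≤ ΛT) (hΛr : ΛT ≤ klScale klE0 jr) (hcW1 : 1 ≤ cW)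
    (hrowT : ∀ x, ∑ y', ‖klLipTransfer (b * L) M β μ K d k x y'‖ *
      klScaleWt (b * L) M β jr {latticeLegPos (2 * (2 * M)) x, latticeLegPos (2 * (2 * M)) y'} ≤ cW)
    (hcolT : ∀ y', ∑ x, ‖klLipTransfer (b * L) M β μ K d k x y'‖ *
      klScaleWt (b * L) M β jr {latticeLegPos (2 * (2 * M)) x, latticeLegPos (2 * (2 * M)) y'} ≤ cW)
    (D₀ r : ℕ) (hD₀ : 2 * r ≤ D₀) (hRR' : R + R' ≤ D₀)
    {n q : ℕ} (hq : 2 * q = n + 1)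
    {N Nfar Es NDs : ℝ} (hN0 : 0 ≤ N) (hNfar0 : 0 ≤ Nfar) (hEs0 : 0 ≤ Es) (hNDs0 : 0 ≤ NDs)
    (hN : ∀ (p : Fin (n + 1)) y, ∑ Y ∈ univ.filter (fun Y : Fin (n + 1) → SrcLabel L M (d * k - 1) => Y p = y),
      ‖kernel ℂ (effAction ℂ (klLipCovD L M β μ K d k) (klLipInputDT L M β U μ K d k) - klLipInputDT L M β U μ K d k) (n + 1) Y‖ ≤ N)
    (hNfar : ∀ (p : Fin (n + 1)) y (i : Fin (n + 1)),
      ∑ Y ∈ univ.filter (fun Y : Fin (n + 1) → SrcLabel L M (d * k - 1) => Y p = y ∧ r < Torus.tnorm ((Y p).1.1.2 - (Y i).1.1.2)),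
        ‖kernel ℂ (effAction ℂ (klLipCovD L M β μ K d k) (klLipInputDT L M β U μ K d k) - klLipInputDT L M β U μ K d k) (n + 1) Y‖ ≤ Nfar)
    (hEs : ∀ (p : Fin (n + 1)) (y' : SrcLabel (b * L) M (d * k - 1)), y' ∈ klDeepPinsD (V := b * L) (M := M) (n := d * k - 1) L D₀ →
      ∑ Y' ∈ univ.filter (fun Y' : Fin (n + 1) → SrcLabel (b * L) M (d * k - 1) => Y' p = y'),
        ‖kernel ℂ ((effAction ℂ (klLipCovD (b * L) M β μ K d k) (klGlueD L b M (d * k - 1) (klLipInputDT L M β U μ K d k)) -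
              klGlueD L b M (d * k - 1) (klLipInputDT L M β U μ K d k)) -
            klGlueD L b M (d * k - 1)
              (effAction ℂ (klLipCovD L M β μ K d k) (klLipInputDT L M β U μ K d k) - klLipInputDT L M β U μ K d k)) (n + 1) Y'‖ ≤ Es)
    (hNDs : ∀ (p : Fin (n + 1)) (y' : SrcLabel (b * L) M (d * k - 1)),
      ∑ Y' ∈ univ.filter (fun Y' : Fin (n + 1) → SrcLabel (b * L) M (d * k - 1) => Y' p = y'),
        ‖kernel ℂ ((effAction ℂ (klLipCovD (b * L) M β μ K d k) (klGlueD L b M (d * k - 1) (klLipInputDT L M β U μ K d k)) -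
              klGlueD L b M (d * k - 1) (klLipInputDT L M β U μ K d k)) -
            klGlueD L b M (d * k - 1)
              (effAction ℂ (klLipCovD L M β μ K d k) (klLipInputDT L M β U μ K d k) - klLipInputDT L M β U μ K d k)) (n + 1) Y'‖ ≤ NDs)
    (p : Fin (n + 1)) (w'' : SrcLabel (b * L) M (d * k)) (hw'' : w''.1 ∈ klDeepPins L (D₀ + r)) :
    ∑ X'' ∈ univ.filter (fun X'' : Fin (n + 1) → SrcLabel (b * L) M (d * k) => X'' p = w''),
        ‖kernel ℂ (klLipBornDiffDT L b M β U μ K d k) (n + 1) X''‖ ≤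
      cW ^ (2 * q - 1) * (cW * (towerFO D (κ ^ 2) E q + Λ⁻¹ * towerFO D (κ ^ 2) ND q) + cW / (1 + ΛT * ((r : ℝ) + 1)) * towerFO D (κ ^ 2) ND q) +
      cW ^ (2 * q - 1) * (cW *
        (((∑ n' ∈ Icc 2 (N₀ - 1), Real.exp 1 * (Real.exp 1 * α / κ ^ 2) ^ (n' - 1) * (ρ⁻¹ ^ 2) ^ q *
              towerSLip D ((Real.exp 2 * (κ + ρ)) ^ 2) E (fun m' => NV m' + ND m' + E m') n' q) +
            2 * ((ρ⁻¹ ^ 2) ^ q * Real.exp 1 * towerV D ((Real.exp 2 * (κ + ρ)) ^ 2) (fun m' => NV m' + ND m' + E m') *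
              (Real.exp 1 * α / κ ^ 2 * towerV D ((Real.exp 2 * (κ + ρ)) ^ 2) (fun m' => NV m' + ND m' + E m')) ^ (N₀ - 1) /
              (1 - Real.exp 1 * α / κ ^ 2 * towerV D ((Real.exp 2 * (κ + ρ)) ^ 2) (fun m' => NV m' + ND m' + E m')))) +
          Λ⁻¹ * ((∑ n' ∈ Icc 2 (N₀ - 1), Real.exp 1 * (Real.exp 1 * α / κ ^ 2) ^ (n' - 1) * (ρ⁻¹ ^ 2) ^ q *
              towerSLip D ((Real.exp 2 * (κ + ρ)) ^ 2) ND (fun m' => NV m' + ND m') n' q) +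
            (2 * Λ) * ((ρ⁻¹ ^ 2) ^ q * Real.exp 1 * towerV D ((Real.exp 2 * (κ + ρ)) ^ 2) (fun m' => NV m' + ND m') *
              (Real.exp 1 * α / κ ^ 2 * towerV D ((Real.exp 2 * (κ + ρ)) ^ 2) (fun m' => NV m' + ND m')) ^ (N₀ - 1) /
              (1 - Real.exp 1 * α / κ ^ 2 * towerV D ((Real.exp 2 * (κ + ρ)) ^ 2) (fun m' => NV m' + ND m'))))) +
        cW / (1 + ΛT * ((r : ℝ) + 1)) * ((∑ n' ∈ Icc 2 (N₀ - 1), Real.exp 1 * (Real.exp 1 * α / κ ^ 2) ^ (n' - 1) * (ρ⁻¹ ^ 2) ^ q *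
              towerSLip D ((Real.exp 2 * (κ + ρ)) ^ 2) ND (fun m' => NV m' + ND m') n' q) +
            2 * ((ρ⁻¹ ^ 2) ^ q * Real.exp 1 * towerV D ((Real.exp 2 * (κ + ρ)) ^ 2) (fun m' => NV m' + ND m') *
              (Real.exp 1 * α / κ ^ 2 * towerV D ((Real.exp 2 * (κ + ρ)) ^ 2) (fun m' => NV m' + ND m')) ^ (N₀ - 1) /
              (1 - Real.exp 1 * α / κ ^ 2 * towerV D ((Real.exp 2 * (κ + ρ)) ^ 2) (fun m' => NV m' + ND m'))))) +
      (cW ^ n * (cW * Es + cW / (1 + ΛT * ((r : ℝ) + 1)) * NDs) +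
        (2 * cW ^ n * (cW / (1 + ΛT * ((r : ℝ) + 1))) * N + n * cW ^ n * (5 * (cW / (1 + ΛT * ((r : ℝ) + 1))) * N + 2 * cW * Nfar))) := by
  have hcW : 0 ≤ cW := zero_le_one.trans hcW1
  have hμ₁0 : ∀ m, 0 ≤ (fun m' => NV m' + ND m' + E m') m := fun m => add_nonneg (add_nonneg (hNV0 m) (hND0 m)) (hE0 m)
  have hμ₁00 : (fun m' => NV m' + ND m' + E m') 0 = 0 := by simp only [hNV00, hND00, hE00, add_zero]
  have hμ₂0 : ∀ m, 0 ≤ (fun m' => NV m' + ND m') m := fun m => add_nonneg (hNV0 m) (hND0 m)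
  have hμ₂00 : (fun m' => NV m' + ND m') 0 = 0 := by simp only [hNV00, hND00, add_zero]
  have hθ₁ := door_theta_lt_one_of_guard (Γ := SrcLabel (b * L) M (d * k - 1)) hκ hρ hα.le hμ₁0 hμ₁00 hD hg₁
  have hθ₂ := door_theta_lt_one_of_guard (Γ := SrcLabel (b * L) M (d * k - 1)) hκ hρ hα.le hμ₂0 hμ₂00 hD hg₂
  have hτT : 0 ≤ cW / (1 + ΛT * ((r : ℝ) + 1)) := by positivity
  exact (klLipBornDiffDT_pinned_le_step_of_profile_rate hβ U μ K hdk hZf hZc hκ hGB NV ND hNV0 hND0 hNV hND R R' E hE0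
      (fun m' j x hx => (sum_le_klLipInputDiffSupDT β U μ K d k (2 * m') R j hx).trans (hE m')) hα hrow hcol hρ hθ₁ hθ₂ hN₀
      (one_pos.trans_le hΛ1) hΛle jr hΛT hΛr hcW1 hrowT hcolT D₀ r hD₀ hRR' hq hN0 hNfar0 hEs0 hNDs0 hN hNfar hEs hNDs p w'' hw'').trans
    (add_le_add (lipDoor_le_kit hκ hρ hα.le hΛ1 hcW hτT hNV0 hND0 hE0 hNV00 hND00 hE00 hD hN₀ hq hg₁ hg₂) le_rfl)

set_option maxHeartbeats 400000 in -- the kit row and the units identity in one declaration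
/-- **The truncated doubled (Db)⁺ row in the kit's dimensionless form, any units `(u, Kc)`** (twin of ✓ `klLipBornDiff_pinned_le_kit_units_rate`) (see the module docstring). -/
theorem klLipBornDiffDT_pinned_le_kit_units_rate {β : ℝ} (hβ : 0 < β) (U μ : ℝ) (K : TrigPolyC4v) {d k jw : ℕ} (hdk : 1 ≤ d * k)
    (hZf : hubbardEffPartitionFnCT (b * L) M β U μ 0 K (klScale klE0 (d * k)) ≠ 0)
    (hZc : hubbardEffPartitionFnCT L M β U μ 0 K (klScale klE0 (d * k)) ≠ 0)
    {κ : ℝ} (hκ : 0 < κ) (hGB : IsGramBoundedR ((sectorSubMatrix (b * L) M β (bgmFatMultiplier (b * L) M klE0 β (nambuXiCT (b * L) μ K) (d * k - 1))).transpose * hubbardCovSliceCT (b * L) M β μ 0 K (klScale klE0 (d * (k + 1))) (klScale klE0 (d * k)) * sectorSubMatrix (b * L) M β (bgmFatMultiplier (b * L) M klE0 β (nambuXiCT (b * L) μ K) (d * k - 1))) κ)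
    {u Kc : ℝ} (hu : 0 < u) (hKc : 0 < Kc) (bV bD : ℕ → ℝ) (hbV0 : ∀ m', 0 ≤ bV m') (hbD0 : ∀ m', 0 ≤ bD m')
    (hNV : ∀ m' (j : Fin (2 * m')) (x : (SrcLabel (b * L) M (d * k - 1))), ∑ Y ∈ univ.filter (fun Y : Fin (2 * m') → (SrcLabel (b * L) M (d * k - 1)) => Y j = x),
      ‖kernel ℂ (klGlueD L b M (d * k - 1) (klLipInputDT L M β U μ K d k)) (2 * m') Y‖ * klGluedWt L b M β jw (sectorCount (d * k - 1)) ((univ.image Y).image Prod.fst) ≤ Kc * (u ^ m' * bV m'))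
    (hND : ∀ m' (j : Fin (2 * m')) (x : (SrcLabel (b * L) M (d * k - 1))), ∑ Y ∈ univ.filter (fun Y : Fin (2 * m') → (SrcLabel (b * L) M (d * k - 1)) => Y j = x),
      ‖kernel ℂ (klLipInputDiffDT L b M β U μ K d k) (2 * m') Y‖ * klGluedWt L b M β jw (sectorCount (d * k - 1)) ((univ.image Y).image Prod.fst) ≤ Kc * (u ^ m' * bD m'))
    (R R' : ℕ) (bE : ℕ → ℝ) (hbE0 : ∀ m', 0 ≤ bE m') (hE : ∀ m', klLipInputDiffSupDT L b M β U μ K d k (2 * m') R ≤ Kc * (u ^ m' * bE m'))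
    (hbV00 : bV 0 = 0) (hbD00 : bD 0 = 0) (hbE00 : bE 0 = 0)
    {α : ℝ} (hα : 0 < α)
    (hrow : ∀ X, ∑ Y, ‖((sectorSubMatrix (b * L) M β (bgmFatMultiplier (b * L) M klE0 β (nambuXiCT (b * L) μ K) (d * k - 1))).transpose * hubbardCovSliceCT (b * L) M β μ 0 K (klScale klE0 (d * (k + 1))) (klScale klE0 (d * k)) * sectorSubMatrix (b * L) M β (bgmFatMultiplier (b * L) M klE0 β (nambuXiCT (b * L) μ K) (d * k - 1))) X Y‖ * klGluedWt L b M β jw (sectorCount (d * k - 1)) {X, Y} ≤ α)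
    (hcol : ∀ Y, ∑ X, ‖((sectorSubMatrix (b * L) M β (bgmFatMultiplier (b * L) M klE0 β (nambuXiCT (b * L) μ K) (d * k - 1))).transpose * hubbardCovSliceCT (b * L) M β μ 0 K (klScale klE0 (d * (k + 1))) (klScale klE0 (d * k)) * sectorSubMatrix (b * L) M β (bgmFatMultiplier (b * L) M klE0 β (nambuXiCT (b * L) μ K) (d * k - 1))) X Y‖ * klGluedWt L b M β jw (sectorCount (d * k - 1)) {X, Y} ≤ α)
    {ρ : ℝ} (hρ : 0 < ρ)
    {D : ℕ} (hD : Fintype.card (SrcLabel (b * L) M (d * k - 1)) / 2 ≤ D)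
    (hg₁ : Real.exp 1 * α / κ ^ 2 * Kc * towerV D ((Real.exp 2 * (κ + ρ)) ^ 2 * u) (fun m => bV m + bD m + bE m) < 1)
    (hg₂ : Real.exp 1 * α / κ ^ 2 * Kc * towerV D ((Real.exp 2 * (κ + ρ)) ^ 2 * u) (fun m => bV m + bD m) < 1)
    {N₀ : ℕ} (hN₀ : 2 ≤ N₀)
    {Λ : ℝ} (hΛ1 : 1 ≤ Λ) (hΛle : Λ ≤ 1 + klScale klE0 jw * ((R' : ℝ) + 1))
    (jr : ℕ) {ΛT cW : ℝ} (hΛT : 0 ≤ ΛT) (hΛr : ΛT ≤ klScale klE0 jr) (hcW1 : 1 ≤ cW)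
    (hrowT : ∀ x, ∑ y', ‖klLipTransfer (b * L) M β μ K d k x y'‖ *
      klScaleWt (b * L) M β jr {latticeLegPos (2 * (2 * M)) x, latticeLegPos (2 * (2 * M)) y'} ≤ cW)
    (hcolT : ∀ y', ∑ x, ‖klLipTransfer (b * L) M β μ K d k x y'‖ *
      klScaleWt (b * L) M β jr {latticeLegPos (2 * (2 * M)) x, latticeLegPos (2 * (2 * M)) y'} ≤ cW)
    (D₀ r : ℕ) (hD₀ : 2 * r ≤ D₀) (hRR' : R + R' ≤ D₀)
    {n q : ℕ} (hq : 2 * q = n + 1)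
    {N Nfar Es NDs : ℝ} (hN0 : 0 ≤ N) (hNfar0 : 0 ≤ Nfar) (hEs0 : 0 ≤ Es) (hNDs0 : 0 ≤ NDs)
    (hN : ∀ (p : Fin (n + 1)) y, ∑ Y ∈ univ.filter (fun Y : Fin (n + 1) → SrcLabel L M (d * k - 1) => Y p = y),
      ‖kernel ℂ (effAction ℂ (klLipCovD L M β μ K d k) (klLipInputDT L M β U μ K d k) - klLipInputDT L M β U μ K d k) (n + 1) Y‖ ≤ N)
    (hNfar : ∀ (p : Fin (n + 1)) y (i : Fin (n + 1)),
      ∑ Y ∈ univ.filter (fun Y : Fin (n + 1) → SrcLabel L M (d * k - 1) => Y p = y ∧ r < Torus.tnorm ((Y p).1.1.2 - (Y i).1.1.2)),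
        ‖kernel ℂ (effAction ℂ (klLipCovD L M β μ K d k) (klLipInputDT L M β U μ K d k) - klLipInputDT L M β U μ K d k) (n + 1) Y‖ ≤ Nfar)
    (hEs : ∀ (p : Fin (n + 1)) (y' : SrcLabel (b * L) M (d * k - 1)), y' ∈ klDeepPinsD (V := b * L) (M := M) (n := d * k - 1) L D₀ →
      ∑ Y' ∈ univ.filter (fun Y' : Fin (n + 1) → SrcLabel (b * L) M (d * k - 1) => Y' p = y'),
        ‖kernel ℂ ((effAction ℂ (klLipCovD (b * L) M β μ K d k) (klGlueD L b M (d * k - 1) (klLipInputDT L M β U μ K d k)) -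
              klGlueD L b M (d * k - 1) (klLipInputDT L M β U μ K d k)) -
            klGlueD L b M (d * k - 1)
              (effAction ℂ (klLipCovD L M β μ K d k) (klLipInputDT L M β U μ K d k) - klLipInputDT L M β U μ K d k)) (n + 1) Y'‖ ≤ Es)
    (hNDs : ∀ (p : Fin (n + 1)) (y' : SrcLabel (b * L) M (d * k - 1)),
      ∑ Y' ∈ univ.filter (fun Y' : Fin (n + 1) → SrcLabel (b * L) M (d * k - 1) => Y' p = y'),
        ‖kernel ℂ ((effAction ℂ (klLipCovD (b * L) M β μ K d k) (klGlueD L b M (d * k - 1) (klLipInputDT L M β U μ K d k)) -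
              klGlueD L b M (d * k - 1) (klLipInputDT L M β U μ K d k)) -
            klGlueD L b M (d * k - 1)
              (effAction ℂ (klLipCovD L M β μ K d k) (klLipInputDT L M β U μ K d k) - klLipInputDT L M β U μ K d k)) (n + 1) Y'‖ ≤ NDs)
    (p : Fin (n + 1)) (w'' : SrcLabel (b * L) M (d * k)) (hw'' : w''.1 ∈ klDeepPins L (D₀ + r)) :
    ∑ X'' ∈ univ.filter (fun X'' : Fin (n + 1) → SrcLabel (b * L) M (d * k) => X'' p = w''),
        ‖kernel ℂ (klLipBornDiffDT L b M β U μ K d k) (n + 1) X''‖ ≤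
      cW ^ (2 * q - 1) * (u ^ q * Kc) *
        (cW * (towerFO D (κ ^ 2 * u) bE q +
            (∑ n' ∈ Icc 2 (N₀ - 1), Real.exp 1 * (Real.exp 1 * α / κ ^ 2 * Kc) ^ (n' - 1) * (ρ⁻¹ ^ 2 / u) ^ q * towerSLip D ((Real.exp 2 * (κ + ρ)) ^ 2 * u) bE (fun m => bV m + bD m + bE m) n' q) +
            2 * ((ρ⁻¹ ^ 2 / u) ^ q * Real.exp 1 * towerV D ((Real.exp 2 * (κ + ρ)) ^ 2 * u) (fun m => bV m + bD m + bE m) *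
              ((Real.exp 1 * α / κ ^ 2 * Kc) * towerV D ((Real.exp 2 * (κ + ρ)) ^ 2 * u) (fun m => bV m + bD m + bE m)) ^ (N₀ - 1) / (1 - (Real.exp 1 * α / κ ^ 2 * Kc) * towerV D ((Real.exp 2 * (κ + ρ)) ^ 2 * u) (fun m => bV m + bD m + bE m)))) +
          cW * Λ⁻¹ * (towerFO D (κ ^ 2 * u) bD q +
            (∑ n' ∈ Icc 2 (N₀ - 1), Real.exp 1 * (Real.exp 1 * α / κ ^ 2 * Kc) ^ (n' - 1) * (ρ⁻¹ ^ 2 / u) ^ q * towerSLip D ((Real.exp 2 * (κ + ρ)) ^ 2 * u) bD (fun m => bV m + bD m) n' q) +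
            (2 * Λ) * ((ρ⁻¹ ^ 2 / u) ^ q * Real.exp 1 * towerV D ((Real.exp 2 * (κ + ρ)) ^ 2 * u) (fun m => bV m + bD m) *
              ((Real.exp 1 * α / κ ^ 2 * Kc) * towerV D ((Real.exp 2 * (κ + ρ)) ^ 2 * u) (fun m => bV m + bD m)) ^ (N₀ - 1) / (1 - (Real.exp 1 * α / κ ^ 2 * Kc) * towerV D ((Real.exp 2 * (κ + ρ)) ^ 2 * u) (fun m => bV m + bD m)))) +
          cW / (1 + ΛT * ((r : ℝ) + 1)) * (towerFO D (κ ^ 2 * u) bD q +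
            (∑ n' ∈ Icc 2 (N₀ - 1), Real.exp 1 * (Real.exp 1 * α / κ ^ 2 * Kc) ^ (n' - 1) * (ρ⁻¹ ^ 2 / u) ^ q * towerSLip D ((Real.exp 2 * (κ + ρ)) ^ 2 * u) bD (fun m => bV m + bD m) n' q) +
            2 * ((ρ⁻¹ ^ 2 / u) ^ q * Real.exp 1 * towerV D ((Real.exp 2 * (κ + ρ)) ^ 2 * u) (fun m => bV m + bD m) *
              ((Real.exp 1 * α / κ ^ 2 * Kc) * towerV D ((Real.exp 2 * (κ + ρ)) ^ 2 * u) (fun m => bV m + bD m)) ^ (N₀ - 1) / (1 - (Real.exp 1 * α / κ ^ 2 * Kc) * towerV D ((Real.exp 2 * (κ + ρ)) ^ 2 * u) (fun m => bV m + bD m))))) +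
      (cW ^ n * (cW * Es + cW / (1 + ΛT * ((r : ℝ) + 1)) * NDs) +
        (2 * cW ^ n * (cW / (1 + ΛT * ((r : ℝ) + 1))) * N + n * cW ^ n * (5 * (cW / (1 + ΛT * ((r : ℝ) + 1))) * N + 2 * cW * Nfar))) := by
  have hμ₁ : (fun m' => Kc * (u ^ m' * bV m') + Kc * (u ^ m' * bD m') + Kc * (u ^ m' * bE m')) = fun m => Kc * (u ^ m * (bV m + bD m + bE m)) :=
    funext fun m => by ring
  have hμ₂ : (fun m' => Kc * (u ^ m' * bV m') + Kc * (u ^ m' * bD m')) = fun m => Kc * (u ^ m * (bV m + bD m)) := funext fun m => by ring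
  have hg₁' : Real.exp 1 * α / κ ^ 2 * towerV D ((Real.exp 2 * (κ + ρ)) ^ 2)
      (fun m' => Kc * (u ^ m' * bV m') + Kc * (u ^ m' * bD m') + Kc * (u ^ m' * bE m')) < 1 := by
    rw [hμ₁, towerV_units, ← mul_assoc]; exact hg₁
  have hg₂' : Real.exp 1 * α / κ ^ 2 * towerV D ((Real.exp 2 * (κ + ρ)) ^ 2) (fun m' => Kc * (u ^ m' * bV m') + Kc * (u ^ m' * bD m')) < 1 := by
    rw [hμ₂, towerV_units, ← mul_assoc]; exact hg₂
  have h := klLipBornDiffDT_pinned_le_kit_rate hβ U μ K hdk hZf hZc hκ hGB (fun m => Kc * (u ^ m * bV m)) (fun m => Kc * (u ^ m * bD m))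
    (fun m' => mul_nonneg hKc.le (mul_nonneg (pow_nonneg hu.le _) (hbV0 m'))) (fun m' => mul_nonneg hKc.le (mul_nonneg (pow_nonneg hu.le _) (hbD0 m')))
    hNV hND R R' (fun m => Kc * (u ^ m * bE m)) (fun m' => mul_nonneg hKc.le (mul_nonneg (pow_nonneg hu.le _) (hbE0 m'))) hE
    (by simp only [hbV00, mul_zero]) (by simp only [hbD00, mul_zero]) (by simp only [hbE00, mul_zero]) hα hrow hcol hρ hD hg₁' hg₂' hN₀ hΛ1 hΛle
    jr hΛT hΛr hcW1 hrowT hcolT D₀ r hD₀ hRR' hq hN0 hNfar0 hEs0 hNDs0 hN hNfar hEs hNDs p w'' hw''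
  rw [lipKit_abs_eq_units hKc.ne' hu.ne'] at h
  exact h

end KitDT

end Summit.HubbardSuperconductivity.HubbardSuperconductivity.Theorems.TwoVolumeLip

end
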